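import Literature.Analysis.Distribution.HeatHypoelliptic
import Literature.Analysis.FluidPDE.ClassicalSolution
import Literature.Analysis.FluidPDE.SpaceTimeCalculus
import Literature.Analysis.FluidPDE.VectorCalculus
import Literature.Analysis.FluidPDE.WholeSpaceIBP

/-!
# Crux `AdaptedKernelExists` (stmt-NavierStokesRegularity-2956), line `nash-entropy-last-block`:
  the Hörmander fields of the backward drift–heat operator
  (helper file for STUB `stub_hypoelliptic`)

Helper file (lands `--supports stmt-NavierStokesRegularity-2956`) for the registered stub
`stub_hypoelliptic` of the line's skeleton (hypoelliptic smoothing of very weak `L¹_loc`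
solutions of the backward drift–heat equation `∂ₜw + b·∇w + νΔw = 0` on an open slab
`(ta, T) × ℝ³`, for a jointly smooth divergence-free drift `b`). The engine is Hörmander's
hypoellipticity theorem for sums of squares (Hörmander 1967, Thm 1.1), PROVED in the tree
(`Literature.Analysis.Hypoelliptic.hormander1967_thm11_proof`, interface
`Literature/Analysis/Distribution/Hypoelliptic.lean`). This file presents the operator in
Hörmander's form on a time WINDOW `U ⊆ (ta, T)` (open, with a smooth time cut-off `η`, `η = 1`
on `U`, `tsupport η ⊆ (ta, T)`), on space-time `ℝ × ℝ³` (time first):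

* the fields `Xⱼ = √ν (0, eⱼ)` (`j = 1, 2, 3`, constant) and `X₀(t, x) = (1, η(t) b(t, x))` are
  smooth on all of `ℝ × ℝ³` (`hypoelliptic_contDiff_driftField`,
  `hypoelliptic_contDiff_squareField`);
* `div X₀ = div b` on the window (`hypoelliptic_fieldDiv_driftField`: the derivative of `X₀` is
  `(0, D(uncurry b))`, whose trace is that of the spatial block);
* the slice dictionary (`hypoelliptic_fderiv_apply_one_zero`, `hypoelliptic_fderiv_apply_zero`,
  `hypoelliptic_sum_fderiv_fderiv`: `Σⱼ D²F((0,eⱼ),(0,eⱼ)) = Δₓ F(t, ·)`);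
* **`hypoelliptic_hormanderTranspose_eq`**: for `φ` smooth and supported in `U × ℝ³`,
  `ᵗP φ = Σⱼ ᵗXⱼ(ᵗXⱼφ) + ᵗX₀φ = −(∂ₜφ + b·∇ₓφ − νΔₓφ)` everywhere (`div b = 0`), whose `ℝ³`-form
  with the standard frame is the registered sub-goal `stub_hypoelliptic_transpose`;
* **`hypoelliptic_hormanderOp_apply`**: for `G` smooth on the slab and `t ∈ U`,
  `P G (t, x) = ∂ₜG + b·∇ₓG + νΔₓG`.

The companion file `…Hypoelliptic` runs Hörmander's theorem window by window, glues, and proves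
the stub.
-/

noncomputable section

open MeasureTheory Set Filter Topology Metric Function Distributions
open scoped ContDiff Laplacian
open Literature.Analysis.FluidPDE Literature.Analysis.Distribution

namespace Summit.NavierStokesRegularity.NavierStokesRegularity.Theorems.AdaptedKernelExists.NashEntropyLastBlock

variable {V : Type*} [NormedAddCommGroup V] [InnerProductSpace ℝ V] [FiniteDimensional ℝ V]
  {ι : Type*} [Fintype ι]

/-! ### Slice derivatives of functions on space-time -/

omit [FiniteDimensional ℝ V] in
/-- The joint derivative in the time direction is the derivative of the time line:
`DF(p)(1, 0) = ∂ₜF(p)`. -/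
theorem hypoelliptic_fderiv_apply_one_zero {F : ℝ × V → ℝ} {p : ℝ × V}
    (hF : DifferentiableAt ℝ F p) :
    fderiv ℝ F p (1, 0) = deriv (fun s => F (s, p.2)) p.1 := by
  have h := hasDerivAt_timeLine (w := fun s y => F (s, y)) (t := p.1) (x := p.2)
    (L := fderiv ℝ F p) hF.hasFDerivAt
  exact h.deriv.symm

omit [FiniteDimensional ℝ V] in
/-- The joint derivative in a spatial direction is the derivative of the slice:
`DF(p)(0, a) = D(F(t, ·))(x) a`. -/
theorem hypoelliptic_fderiv_apply_zero {F : ℝ × V → ℝ} {p : ℝ × V} (hF : DifferentiableAt ℝ F p)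
    (a : V) :
    fderiv ℝ F p (0, a) = fderiv ℝ (fun y => F (p.1, y)) p.2 a := by
  have h := hasFDerivAt_slice (w := fun s y => F (s, y)) (t := p.1) (x := p.2)
    (L := fderiv ℝ F p) hF.hasFDerivAt
  rw [h.fderiv]
  simp

omit [FiniteDimensional ℝ V] in
/-- Scaling a direction scales the pure second derivative quadratically. -/
theorem hypoelliptic_fderiv_fderiv_smul {F : ℝ × V → ℝ} {p : ℝ × V} (u : ℝ × V) (c : ℝ)
    (hd : DifferentiableAt ℝ (fun z => fderiv ℝ F z u) p) :
    fderiv ℝ (fun z => fderiv ℝ F z (c • u)) p (c • u) =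
      c * c * fderiv ℝ (fun z => fderiv ℝ F z u) p u := by
  have h1 : (fun z => fderiv ℝ F z (c • u)) = fun z => c * fderiv ℝ F z u := by
    funext z; rw [map_smul, smul_eq_mul]
  rw [h1, fderiv_const_mul hd c]
  simp only [FunLike.coe_smul, Pi.smul_apply, map_smul, smul_eq_mul]
  ring

/-- The sum of the pure second joint derivatives in the spatial directions of an orthonormal
frame is the Laplacian of the slice: `Σᵢ D²F(t, x)((0, eᵢ), (0, eᵢ)) = Δ(F(t, ·))(x)`, for `F`
smooth on an open slab `S × V`. -/
theorem hypoelliptic_sum_fderiv_fderiv {S : Set ℝ} (hS : IsOpen S) {F : ℝ × V → ℝ}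
    (hF : ContDiffOn ℝ ∞ F (S ×ˢ univ)) (e : OrthonormalBasis ι ℝ V)
    {t : ℝ} (ht : t ∈ S) (x : V) :
    ∑ i, fderiv ℝ (fun z => fderiv ℝ F z (0, e i)) (t, x) (0, e i) = (Δ fun y => F (t, y)) x := by
  have hO : IsOpen (S ×ˢ (univ : Set V)) := hS.prod isOpen_univ
  obtain ⟨H₁, hH₁⟩ : ∃ H₁ : ℝ × V → (ℝ × V →L[ℝ] ℝ), H₁ = fderiv ℝ F := ⟨_, rfl⟩
  have hH₁c : ContDiffOn ℝ 1 H₁ (S ×ˢ univ) := by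
    rw [hH₁]; exact hF.fderiv_of_isOpen hO (WithTop.coe_le_coe.2 le_top)
  have hD1 : ∀ p ∈ S ×ˢ (univ : Set V), ∀ v,
      fderiv ℝ (fun y => F (p.1, y)) p.2 v = H₁ p (0, v) := by
    rintro p hp v
    have hd : DifferentiableAt ℝ F p :=
      (hF.differentiableOn (by simp)).differentiableAt (hO.mem_nhds hp)
    rw [hH₁, hypoelliptic_fderiv_apply_zero hd]
  have hD2 : ∀ v, fderiv ℝ (fun y => fderiv ℝ (fun y' => F (t, y')) y v) x v =
      fderiv ℝ H₁ (t, x) (0, v) (0, v) := by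
    intro v
    have heq : (fun y => fderiv ℝ (fun y' => F (t, y')) y v) = fun y => H₁ (t, y) (0, v) :=
      funext fun y => hD1 (t, y) ⟨ht, mem_univ y⟩ v
    have hd : HasFDerivAt (uncurry fun s y => H₁ (s, y)) (fderiv ℝ H₁ (t, x)) (t, x) :=
      ((hH₁c.differentiableOn one_ne_zero).differentiableAt
        (hO.mem_nhds ⟨ht, mem_univ x⟩)).hasFDerivAt
    have hsl : HasFDerivAt (fun y => H₁ (t, y))
        ((fderiv ℝ H₁ (t, x)).comp (ContinuousLinearMap.inr ℝ ℝ V)) x :=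
      hasFDerivAt_slice (w := fun s y => H₁ (s, y)) hd
    rw [heq, (hsl.clm_apply (hasFDerivAt_const ((0 : ℝ), v) x)).fderiv]
    simp
  have hD2' : ∀ v, fderiv ℝ (fun z => fderiv ℝ F z (0, v)) (t, x) (0, v) =
      fderiv ℝ H₁ (t, x) (0, v) (0, v) := by
    intro v
    have hd : DifferentiableAt ℝ H₁ (t, x) :=
      (hH₁c.differentiableOn one_ne_zero).differentiableAt (hO.mem_nhds ⟨ht, mem_univ x⟩)
    rw [← hH₁, fderiv_clm_apply hd (differentiableAt_const _)]
    simp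
  have h2 : ContDiff ℝ 2 (fun y => F (t, y)) := by
    have hc : ContDiff ℝ 2 (fun y : V => ((t, y) : ℝ × V)) := contDiff_const.prodMk contDiff_id
    exact (hF.of_le (WithTop.coe_le_coe.2 le_top)).comp_contDiff hc
      (fun y => mk_mem_prod ht (mem_univ y))
  rw [laplacian_eq_sum_fderiv_fderiv e h2 x]
  exact Finset.sum_congr rfl fun i _ => by rw [hD2' (e i), hD2 (e i)]

omit [InnerProductSpace ℝ V] [FiniteDimensional ℝ V] in
/-- Off the topological support of `φ` the time line and the slice of `φ` vanish near the base
point, so all slice derivatives vanish there. -/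
theorem hypoelliptic_slice_eventuallyEq_zero {φ : ℝ × V → ℝ} {p : ℝ × V} (hp : p ∉ tsupport φ) :
    (fun s => φ (s, p.2)) =ᶠ[𝓝 p.1] 0 ∧ (fun y => φ (p.1, y)) =ᶠ[𝓝 p.2] 0 := by
  have h := notMem_tsupport_iff_eventuallyEq.1 hp
  constructor
  · have hc : Tendsto (fun s : ℝ => ((s, p.2) : ℝ × V)) (𝓝 p.1) (𝓝 p) :=
      (continuous_id.prodMk continuous_const).tendsto p.1
    exact hc.eventually h
  · have hc : Tendsto (fun y : V => ((p.1, y) : ℝ × V)) (𝓝 p.2) (𝓝 p) :=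
      (continuous_const.prodMk continuous_id).tendsto p.2
    exact hc.eventually h

/-- Off `tsupport φ`: `∂ₜφ = 0`, `D(φ(t, ·))(x) = 0` and `Δ(φ(t, ·))(x) = 0`. -/
theorem hypoelliptic_slice_derivs_eq_zero {φ : ℝ × V → ℝ} {p : ℝ × V} (hp : p ∉ tsupport φ) :
    deriv (fun s => φ (s, p.2)) p.1 = 0 ∧ fderiv ℝ (fun y => φ (p.1, y)) p.2 = 0 ∧
      (Δ fun y => φ (p.1, y)) p.2 = 0 := by
  obtain ⟨h1, h2⟩ := hypoelliptic_slice_eventuallyEq_zero hp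
  refine ⟨?_, ?_, ?_⟩
  · rw [h1.deriv_eq]; exact deriv_const p.1 0
  · rw [h2.fderiv_eq]; exact fderiv_const_apply 0
  · exact laplacian_eq_zero_of_notMem_tsupport (notMem_tsupport_iff_eventuallyEq.2 h2)

/-! ### The Hörmander fields `X₀ = (1, η b)`, `Xⱼ = √ν (0, eⱼ)` -/

omit [FiniteDimensional ℝ V] in
/-- A time cut-off `η` supported inside the open time interval where `b` is jointly smooth makes
`p ↦ η(t) b(t, x)` smooth on all of space-time. -/
theorem hypoelliptic_contDiff_smul_drift {ta T : ℝ} {b : ℝ → V → V}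
    (hb : IsSmoothSpaceTimeOn (Ico ta T) b) {η : ℝ → ℝ} (hη : ContDiff ℝ ∞ η)
    (hηs : tsupport η ⊆ Ioo ta T) :
    ContDiff ℝ ∞ fun p : (ℝ × V) => η p.1 • b p.1 p.2 := by
  have hO : IsOpen (Ioo ta T ×ˢ (univ : Set V)) := isOpen_Ioo.prod isOpen_univ
  have hb' : ContDiffOn ℝ ∞ (uncurry b) (Ioo ta T ×ˢ univ) :=
    hb.mono Ioo_subset_Ico_self
  have hη' : ContDiff ℝ ∞ fun p : (ℝ × V) => η p.1 := hη.comp contDiff_fst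
  refine contDiff_iff_contDiffAt.2 fun p => ?_
  by_cases hp : p.1 ∈ Ioo ta T
  · have hbp : ContDiffAt ℝ ∞ (uncurry b) p :=
      hb'.contDiffAt (hO.mem_nhds ⟨hp, mem_univ _⟩)
    exact hη'.contDiffAt.smul hbp
  · have hp' : p.1 ∉ tsupport η := fun h => hp (hηs h)
    have hev : η =ᶠ[𝓝 p.1] 0 := notMem_tsupport_iff_eventuallyEq.1 hp'
    have hev' : (fun q : (ℝ × V) => η q.1 • b q.1 q.2) =ᶠ[𝓝 p] fun _ => 0 := by
      have hc : Tendsto (fun q : (ℝ × V) => q.1) (𝓝 p) (𝓝 p.1) := continuous_fst.tendsto p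
      filter_upwards [hc.eventually hev] with q hq
      rw [hq, Pi.zero_apply, zero_smul]
    exact (contDiffAt_const (c := (0 : V))).congr_of_eventuallyEq hev'

omit [FiniteDimensional ℝ V] in
/-- The drift field `X₀(t, x) = (1, η(t) b(t, x))` is smooth on space-time. -/
theorem hypoelliptic_contDiff_driftField {ta T : ℝ} {b : ℝ → V → V}
    (hb : IsSmoothSpaceTimeOn (Ico ta T) b) {η : ℝ → ℝ} (hη : ContDiff ℝ ∞ η)
    (hηs : tsupport η ⊆ Ioo ta T) {X₀ : ℝ × V → ℝ × V}
    (hX₀ : X₀ = fun p => ((1 : ℝ), η p.1 • b p.1 p.2)) : ContDiff ℝ ∞ X₀ := by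
  rw [hX₀]
  exact contDiff_const.prodMk (hypoelliptic_contDiff_smul_drift hb hη hηs)

/-- On a time window `U` where `η = 1`, the divergence of the drift field `X₀ = (1, η b)` at
`(t, x)` is the spatial divergence `div (b t) x` (the derivative is `(0, D(uncurry b))`, whose
trace is the trace of the spatial block). -/
theorem hypoelliptic_fieldDiv_driftField {ta T : ℝ} {b : ℝ → V → V}
    (hb : IsSmoothSpaceTimeOn (Ico ta T) b) {η : ℝ → ℝ} {U : Set ℝ} (hU : IsOpen U)
    (hUs : U ⊆ Ioo ta T) (hηU : ∀ s ∈ U, η s = 1) {X₀ : ℝ × V → ℝ × V}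
    (hX₀ : X₀ = fun p => ((1 : ℝ), η p.1 • b p.1 p.2)) {p : ℝ × V} (hp : p.1 ∈ U) :
    fieldDiv X₀ p = VectorCalculus.divergence (b p.1) p.2 := by
  have hO : IsOpen (Ioo ta T ×ˢ (univ : Set V)) := isOpen_Ioo.prod isOpen_univ
  have hb' : ContDiffOn ℝ ∞ (uncurry b) (Ioo ta T ×ˢ univ) :=
    hb.mono Ioo_subset_Ico_self
  have hpO : p ∈ Ioo ta T ×ˢ (univ : Set V) := ⟨hUs hp, mem_univ _⟩
  have hd : HasFDerivAt (uncurry b) (fderiv ℝ (uncurry b) p) p :=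
    ((hb'.differentiableOn (by simp)).differentiableAt (hO.mem_nhds hpO)).hasFDerivAt
  set D : ℝ × V →L[ℝ] V := fderiv ℝ (uncurry b) p with hD
  -- near `p` the field is `(1, 0) + inr (uncurry b)`
  have hev : X₀ =ᶠ[𝓝 p] fun q =>
      ((1 : ℝ), (0 : V)) + ContinuousLinearMap.inr ℝ ℝ V (uncurry b q) := by
    have hc : Tendsto (fun q : (ℝ × V) => q.1) (𝓝 p) (𝓝 p.1) := continuous_fst.tendsto p
    filter_upwards [hc.eventually (hU.mem_nhds hp)] with q hq
    rw [hX₀]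
    refine Prod.ext ?_ ?_
    · simp
    · simp [hηU q.1 hq, Function.uncurry]
  have hY : HasFDerivAt
      (fun q : ℝ × V => ((1 : ℝ), (0 : V)) + ContinuousLinearMap.inr ℝ ℝ V (uncurry b q))
      ((ContinuousLinearMap.inr ℝ ℝ V).comp D) p :=
    (((ContinuousLinearMap.inr ℝ ℝ V).hasFDerivAt).comp p hd).const_add _
  have hX : HasFDerivAt X₀ ((ContinuousLinearMap.inr ℝ ℝ V).comp D) p :=
    hY.congr_of_eventuallyEq hev
  unfold fieldDiv
  rw [hX.fderiv]
  have hcoe :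
      (((ContinuousLinearMap.inr ℝ ℝ V).comp D : ℝ × V →L[ℝ] (ℝ × V)) : ℝ × V →ₗ[ℝ] (ℝ × V)) =
      (ContinuousLinearMap.inr ℝ ℝ V : V →ₗ[ℝ] (ℝ × V)) ∘ₗ (D : ℝ × V →ₗ[ℝ] V) := rfl
  rw [hcoe, LinearMap.trace_comp_comm', VectorCalculus.divergence, (hasFDerivAt_slice hd).fderiv]
  rfl

omit [FiniteDimensional ℝ V] in
/-- The square fields `Xⱼ = √ν (0, eⱼ)` are constant, hence smooth. -/
theorem hypoelliptic_contDiff_squareField {ν : ℝ} (e : OrthonormalBasis ι ℝ V)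
    {X : ι → ℝ × V → ℝ × V} (hX : X = fun j _ => Real.sqrt ν • (((0 : ℝ), e j) : ℝ × V)) (j : ι) :
    ContDiff ℝ ∞ (X j) := by
  rw [hX]
  exact contDiff_const

/-- **The formal transpose on a window.** On a time window `U` (open, `η = 1` on `U`,
`U ⊆ (ta, T)` where `div b = 0`), for every smooth `φ` and `t ∈ U`:
`ᵗP φ (t, x) = Σⱼ ᵗXⱼ(ᵗXⱼ φ) + ᵗX₀ φ = −(∂ₜφ + b·∇ₓφ − νΔₓφ)(t, x)`
(constant square fields: `ᵗXⱼᵗXⱼφ = ν D²φ((0,eⱼ),(0,eⱼ))`, summing to `νΔₓφ`; drift field: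
`ᵗX₀ φ = −Dφ(1, b) − (div X₀) φ` with `div X₀ = div b = 0`). -/
theorem hypoelliptic_hormanderTranspose_apply {ν ta T : ℝ} {b : ℝ → V → V} (hν : 0 < ν)
    (hb : IsSmoothSpaceTimeOn (Ico ta T) b)
    (hdiv : ∀ t ∈ Ico ta T, VectorCalculus.IsDivFree (b t))
    {η : ℝ → ℝ} {U : Set ℝ} (hU : IsOpen U) (hUs : U ⊆ Ioo ta T) (hηU : ∀ s ∈ U, η s = 1)
    (e : OrthonormalBasis ι ℝ V) {X₀ : ℝ × V → ℝ × V}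
    (hX₀ : X₀ = fun p => ((1 : ℝ), η p.1 • b p.1 p.2)) {X : ι → ℝ × V → ℝ × V}
    (hX : X = fun j _ => Real.sqrt ν • (((0 : ℝ), e j) : ℝ × V)) {φ : ℝ × V → ℝ}
    (hφ : ContDiff ℝ ∞ φ)
    {t : ℝ} (ht : t ∈ U) (x : V) :
    hormanderTranspose X₀ X (fun _ => 0) φ (t, x) =
      -(deriv (fun s => φ (s, x)) t + fderiv ℝ (fun y => φ (t, y)) x (b t x) -
        ν * (Δ fun y => φ (t, y)) x) := by
  have hφd : DifferentiableAt ℝ φ (t, x) := hφ.differentiable (by simp) _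
  have hDφ : ContDiff ℝ ∞ (fderiv ℝ φ) := hφ.fderiv_right (m := ∞) (by exact_mod_cast le_top)
  -- the squares
  have hsq : ∀ j, fieldTranspose (X j) (fieldTranspose (X j) φ) (t, x) =
      ν * fderiv ℝ (fun z => fderiv ℝ φ z (0, e j)) (t, x) (0, e j) := by
    intro j
    have hd : DifferentiableAt ℝ (fun z => fderiv ℝ φ z (0, e j)) (t, x) :=
      (hDφ.clm_apply contDiff_const).differentiable (by simp) _
    rw [hX]
    simp only [fieldTranspose_const_eq, fderiv_fun_neg, neg_apply, neg_neg]
    rw [hypoelliptic_fderiv_fderiv_smul _ _ hd, Real.mul_self_sqrt hν.le]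
  have hsum : ∑ j, fieldTranspose (X j) (fieldTranspose (X j) φ) (t, x) =
      ν * (Δ fun y => φ (t, y)) x := by
    simp only [hsq]
    rw [← Finset.mul_sum, hypoelliptic_sum_fderiv_fderiv isOpen_univ (F := φ)
      (by rw [univ_prod_univ]; exact hφ.contDiffOn) e (mem_univ t) x]
  -- the drift field
  have hdivX : fieldDiv X₀ (t, x) = 0 := by
    rw [hypoelliptic_fieldDiv_driftField hb hU hUs hηU hX₀ (p := (t, x)) ht]
    exact hdiv t (Ioo_subset_Ico_self (hUs ht)) x
  have hX₀t : X₀ (t, x) = ((1 : ℝ), (0 : V)) + ((0 : ℝ), b t x) := by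
    rw [hX₀]
    simp [hηU t ht]
  have hdrift : fieldTranspose X₀ φ (t, x) =
      -(deriv (fun s => φ (s, x)) t + fderiv ℝ (fun y => φ (t, y)) x (b t x)) := by
    simp only [fieldTranspose, fieldDeriv_apply, hdivX, zero_mul, sub_zero]
    rw [hX₀t, map_add, hypoelliptic_fderiv_apply_one_zero hφd,
      hypoelliptic_fderiv_apply_zero hφd]
  unfold hormanderTranspose
  rw [hsum, hdrift]
  ring

/-- The transpose identity of `hypoelliptic_hormanderTranspose_apply` at every point of
space-time, for `φ` supported in the window `U × ℝ³` (both sides vanish off `tsupport φ`). -/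
theorem hypoelliptic_hormanderTranspose_eq {ν ta T : ℝ} {b : ℝ → V → V} (hν : 0 < ν)
    (hb : IsSmoothSpaceTimeOn (Ico ta T) b)
    (hdiv : ∀ t ∈ Ico ta T, VectorCalculus.IsDivFree (b t))
    {η : ℝ → ℝ} {U : Set ℝ} (hU : IsOpen U) (hUs : U ⊆ Ioo ta T) (hηU : ∀ s ∈ U, η s = 1)
    (e : OrthonormalBasis ι ℝ V) {X₀ : ℝ × V → ℝ × V}
    (hX₀ : X₀ = fun p => ((1 : ℝ), η p.1 • b p.1 p.2)) {X : ι → ℝ × V → ℝ × V}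
    (hX : X = fun j _ => Real.sqrt ν • (((0 : ℝ), e j) : ℝ × V)) {φ : ℝ × V → ℝ}
    (hφ : ContDiff ℝ ∞ φ)
    (hφU : tsupport φ ⊆ Prod.fst ⁻¹' U) (p : ℝ × V) :
    hormanderTranspose X₀ X (fun _ => 0) φ p =
      -(deriv (fun s => φ (s, p.2)) p.1 + fderiv ℝ (fun y => φ (p.1, y)) p.2 (b p.1 p.2) -
        ν * (Δ fun y => φ (p.1, y)) p.2) := by
  by_cases hp : p ∈ tsupport φ
  · obtain ⟨t, x⟩ := p
    exact hypoelliptic_hormanderTranspose_apply hν hb hdiv hU hUs hηU e hX₀ hX hφ (hφU hp) x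
  · obtain ⟨h1, h2, h3⟩ := hypoelliptic_slice_derivs_eq_zero hp
    rw [h1, h2, h3, image_eq_zero_of_notMem_tsupport
      (fun h => hp (tsupport_hormanderTranspose_subset X₀ X _ φ h))]
    simp

/-- **The operator on a window.** For `G` smooth on the open slab `(ta, T) × ℝ³` and `t` in the
window `U`: `P G (t, x) = Σⱼ Xⱼ(Xⱼ G) + X₀ G = ∂ₜG + b·∇ₓG + νΔₓG` at `(t, x)`. -/
theorem hypoelliptic_hormanderOp_apply {ν ta T : ℝ} {b : ℝ → V → V} (hν : 0 < ν)
    {η : ℝ → ℝ} {U : Set ℝ} (hUs : U ⊆ Ioo ta T) (hηU : ∀ s ∈ U, η s = 1)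
    (e : OrthonormalBasis ι ℝ V) {X₀ : ℝ × V → ℝ × V}
    (hX₀ : X₀ = fun p => ((1 : ℝ), η p.1 • b p.1 p.2)) {X : ι → ℝ × V → ℝ × V}
    (hX : X = fun j _ => Real.sqrt ν • (((0 : ℝ), e j) : ℝ × V)) {G : ℝ × V → ℝ}
    (hG : ContDiffOn ℝ ∞ G (Ioo ta T ×ˢ univ)) {t : ℝ} (ht : t ∈ U) (x : V) :
    hormanderOp X₀ X (fun _ => 0) G (t, x) =
      deriv (fun s => G (s, x)) t + fderiv ℝ (fun y => G (t, y)) x (b t x) +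
        ν * (Δ fun y => G (t, y)) x := by
  have hO : IsOpen (Ioo ta T ×ˢ (univ : Set V)) := isOpen_Ioo.prod isOpen_univ
  have hpO : ((t, x) : ℝ × V) ∈ Ioo ta T ×ˢ (univ : Set V) := ⟨hUs ht, mem_univ _⟩
  have hGd : DifferentiableAt ℝ G (t, x) :=
    (hG.differentiableOn (by simp)).differentiableAt (hO.mem_nhds hpO)
  have hDG : ContDiffOn ℝ ∞ (fderiv ℝ G) (Ioo ta T ×ˢ univ) :=
    hG.fderiv_of_isOpen hO (by exact_mod_cast le_top)
  have hsq : ∀ j, fieldDeriv (X j) (fieldDeriv (X j) G) (t, x) =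
      ν * fderiv ℝ (fun z => fderiv ℝ G z (0, e j)) (t, x) (0, e j) := by
    intro j
    have hd : DifferentiableAt ℝ (fun z => fderiv ℝ G z (0, e j)) (t, x) :=
      ((hDG.clm_apply contDiffOn_const).differentiableOn (by simp)).differentiableAt
        (hO.mem_nhds hpO)
    have h1 : fieldDeriv (X j) G =
        fun z => fderiv ℝ G z (Real.sqrt ν • (((0 : ℝ), e j) : ℝ × V)) := by
      funext z; rw [fieldDeriv_apply, hX]
    rw [fieldDeriv_apply, h1, hX]
    exact (hypoelliptic_fderiv_fderiv_smul _ _ hd).trans (by rw [Real.mul_self_sqrt hν.le])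
  have hsum : ∑ j, fieldDeriv (X j) (fieldDeriv (X j) G) (t, x) = ν * (Δ fun y => G (t, y)) x := by
    simp only [hsq]
    rw [← Finset.mul_sum, hypoelliptic_sum_fderiv_fderiv isOpen_Ioo hG e (hUs ht) x]
  have hX₀t : X₀ (t, x) = ((1 : ℝ), (0 : V)) + ((0 : ℝ), b t x) := by
    rw [hX₀]
    simp [hηU t ht]
  have hdrift : fieldDeriv X₀ G (t, x) =
      deriv (fun s => G (s, x)) t + fderiv ℝ (fun y => G (t, y)) x (b t x) := by
    rw [fieldDeriv_apply, hX₀t, map_add, hypoelliptic_fderiv_apply_one_zero hGd,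
      hypoelliptic_fderiv_apply_zero hGd]
  unfold hormanderOp
  rw [hsum, hdrift]
  ring

/-- **Registered sub-goal `stub_hypoelliptic_transpose`** (the `ℝ³` form of
`hypoelliptic_hormanderTranspose_eq` with the standard frame): on a window `U` of a jointly
smooth divergence-free drift, the formal transpose of `P = Σⱼ (√ν ∂ⱼ)² + (1, ηb)` on test
functions supported in `U × ℝ³` is `−(∂ₜ + b·∇ₓ − νΔₓ)`. -/
theorem stub_hypoelliptic_transpose :
    ∀ (ν ta T : ℝ) (b : ℝ → EuclideanSpace ℝ (Fin 3) → EuclideanSpace ℝ (Fin 3)) (η : ℝ → ℝ) (U : Set ℝ) (φ : ℝ × EuclideanSpace ℝ (Fin 3) → ℝ), 0 < ν → IsSmoothSpaceTimeOn (Ico ta T) b → (∀ t ∈ Ico ta T, VectorCalculus.IsDivFree (b t)) → IsOpen U → U ⊆ Ioo ta T → (∀ s ∈ U, η s = 1) → ContDiff ℝ ∞ φ → tsupport φ ⊆ Prod.fst ⁻¹' U → ∀ p : ℝ × EuclideanSpace ℝ (Fin 3), Literature.Analysis.Distribution.hormanderTranspose (fun q : ℝ × EuclideanSpace ℝ (Fin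 3) => ((1 : ℝ), η q.1 • b q.1 q.2)) (fun (j : Fin 3) (_ : ℝ × EuclideanSpace ℝ (Fin 3)) => Real.sqrt ν • (((0 : ℝ), (EuclideanSpace.basisFun (Fin 3) ℝ) j) : ℝ × EuclideanSpace ℝ (Fin 3))) (fun _ => (0 : ℝ)) φ p = -(deriv (fun s => φ (s, p.2)) p.1 + fderiv ℝ (fun y => φ (p.1, y)) p.2 (b p.1 p.2) - ν * (Δ (fun y => φ (p.1, y))) p.2) :=
  fun _ _ _ _ _ _ _ hν hb hdiv hU hUs hηU hφ hφU p =>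
    hypoelliptic_hormanderTranspose_eq hν hb hdiv hU hUs hηU (EuclideanSpace.basisFun (Fin 3) ℝ)
      rfl rfl hφ hφU p

end Summit.NavierStokesRegularity.NavierStokesRegularity.Theorems.AdaptedKernelExists.NashEntropyLastBlock
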